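import Literature.Probability.LatticeModels.GinibreCharacterExpansion
import Mathlib.Analysis.SpecialFunctions.Integrals.Basic
import Mathlib.Analysis.SpecialFunctions.Gaussian.GaussianIntegral
import Mathlib.Analysis.SpecialFunctions.Trigonometric.Bounds
import Mathlib.Analysis.SpecialFunctions.Arsinh
import Mathlib.Analysis.Real.Pi.Bounds
import Mathlib.Analysis.Complex.ExponentialBounds
import HarnessLib

/-!
# Uniform (Debye-type) asymptotics of the modified Bessel functions `I_n(x)` at integer order:
Fröhlich–Spencer's Appendix B estimate (B.12) with an explicit constant

The dual plaquette weights of four-dimensional `U(1)` lattice gauge theory with Wilson's action are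
`I_n(β)` (`U1DualRepresentation`, `U1DualFluxEnsemble`); for the Villain action they are Gaussian.
Fröhlich–Spencer prove the weak-coupling perimeter law for the Villain action and state
([FS82, p. 433]) that the Wilson action is covered "by combining the present techniques with an
adaptation of Appendix B, Lemma 4.3 and of the methods in Sect. 6 of [FS81]"; that Appendix B
constructs an analytic interpolation `I_β(φ) = L_β(φ)E_β(φ)` of `n ↦ I_n(β)` (FS81 (B.14)) whose only
non-elementary input is the **uniform leading-order asymptotics at integer order**
(FS81 (B.11)–(B.12)):

  `I_n(β) = L_β(n)(1 + O(σ⁻²))` for all `n ∈ ℤ`, `σ² = (β² + n²)^{1/2}`,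
  `L_β(n) = (2π)^{-1/2} (β² + n²)^{-1/4} exp[(β² + n²)^{1/2} - n sinh⁻¹(n/β)]`.

This file proves it, for the tree's power-series `besselI : ℤ → ℝ → ℝ`
(`GinibreCharacterExpansion`), with an explicit constant and following the printed proof
(FS81 (B.1)–(B.11): steepest descent through the saddle `θ_c = i sinh⁻¹(n/β)`). Everything is a
theorem; there are no definitions and no named facts.

* `hasSum_besselI_mul_zpow_of_ne_zero`, `hasSum_besselI_mul_exp` — the Laurent generating function
  `∑_m I_m(x) z^m = e^{(x/2)(z + z⁻¹)}` for all `z ≠ 0`, i.e. `∑_m I_m(x) e^{mw} = e^{x cosh w}`;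
* `integral_cexp_cosh_mul_cexp`, `besselI_eq_integral_cosh` — FS81 (B.3)–(B.4), the contour shifted
  to `Im θ = r`: `I_n(x) = (e^{-nr}/2π) ∫_{-π}^{π} e^{x cosh r cos t} cos(x sinh r sin t - nt) dt` for
  EVERY real `r` (proved here without Cauchy's theorem: integrate the absolutely convergent Laurent
  expansion on the circle `|z| = e^r` term by term against `e^{-int}`);
* `besselI_eq_integral_saddle` — the saddle-point choice `x sinh r = n` (FS81 (B.2)):
  `I_n(x) = (e^{-n sinh⁻¹(n/x)}/2π) ∫_{-π}^{π} e^{√(x²+n²) cos t} cos(n(sin t - t)) dt`;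
* `laplace_pointwise`, `laplace_estimate` — FS81 (B.6)–(B.11) with constants: for `s > 0`, `n² ≤ s²`,
  `|∫_{-π}^{π} e^{-s(1 - cos t)} cos(n(sin t - t)) dt - √(2π/s)| ≤ 125/(s√s)`, from
  `1 - cos t ≥ 2t²/π²` on `[-π, π]`, `0 ≤ cos t - 1 + t²/2 ≤ t⁴/24`, `|t - sin t| ≤ |t|³/6`,
  `uᵏe^{-u} ≤ kᵏe^{-k}` and the Gaussian integral;
* `abs_besselI_mul_debye_sub_one_le` — **(B.12) with constant 50**: for all `x > 0`, `n ∈ ℤ`,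
  `|I_n(x) · √(2π√(x²+n²)) · e^{n sinh⁻¹(n/x) - √(x²+n²)} - 1| ≤ 50/√(x²+n²)` (`≤ 50/x` uniformly
  in `n`); `besselI_mem_Icc_debye` (two-sided form) and `abs_log_besselI_sub_debye_le` (the
  logarithmic form `|ln I_n(x) - ln L_x(n)| ≤ 100/√(x²+n²)` for `x ≥ 100`, as consumed by FS81 (B.14)).

What is NOT here: the interpolation `I_β(φ)` itself and properties (a)–(d) of FS81 Sect. 6, p. 576
(`(c)`: `|I_β(φ+ia)/I_β(φ)| ≤ e^{g(a)/β}`, `0 ≤ g(a) ≤ const a²` for `|a| ≤ 1`, `≤ const e^{2π|a|}`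
for `1 ≤ |a| ≤ β/2`; `(d)`: `|∂_φ^m log(I_β(φ+ia)/I_β(φ))| ≤ Cβ⁻¹e^{2π|a|}`, `m = 1, 2`), which
follow from (B.12)–(B.14) by Taylor's theorem ([FS81, p. 599]); and the higher Debye corrections.

## References

* J. Fröhlich, T. Spencer, *The Kosterlitz–Thouless transition in two-dimensional abelian spin
  systems and the Coulomb gas*, Comm. Math. Phys. 81 (1981) 527–602: Appendix B, (B.1)–(B.14),
  pp. 597–599; Sect. 6, conditions (a)–(d), p. 576. [FrohlichSpencerKT1981]
* J. Fröhlich, T. Spencer, *Massless phases and symmetry restoration in abelian gauge theories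
  and spin systems*, Comm. Math. Phys. 83 (1982) 411–454, p. 433. [FrohlichSpencerCMP1982]
* I. Montvay, G. Münster, *Quantum Fields on a Lattice* (1994), §3.2.7 (3.169)–(3.172) (the
  generating function). [MontvayMunster1994]
-/

noncomputable section

open MeasureTheory Set Filter Real Complex intervalIntegral
open scoped Topology BigOperators

namespace Literature.Probability.LatticeModels

/-- **Laurent generating function of the modified Bessel functions**:
`∑_{m ∈ ℤ} I_m(x) z^m = e^{(x/2) z} e^{(x/2) z⁻¹}` for every `z ≠ 0` (absolutely convergent Laurent
series; on `|z| = 1` this is `hasSum_besselI_mul_zpow`). [cite: MontvayMunster1994, §3.2.7 (3.169)–(3.172)] -/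
theorem hasSum_besselI_mul_zpow_of_ne_zero (x : ℝ) {z : ℂ} (hz : z ≠ 0) :
    HasSum (fun m : ℤ => (besselI m x : ℂ) * z ^ m)
      (Complex.exp ((x : ℂ) / 2 * z) * Complex.exp ((x : ℂ) / 2 * z⁻¹)) :=
  (hasSum_cauchy_diag x z).prod_fiberwise (hasSum_cauchy_fiber x hz)

/-- The generating function in exponential form: `∑_m I_m(x) e^{m w} = e^{x cosh w}` for every
complex `w`. [folklore] -/
theorem hasSum_besselI_mul_exp (x : ℝ) (w : ℂ) :
    HasSum (fun m : ℤ => (besselI m x : ℂ) * Complex.exp (m * w))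
      (Complex.exp (x * Complex.cosh w)) := by
  have h := hasSum_besselI_mul_zpow_of_ne_zero x (Complex.exp_ne_zero w)
  have h1 : Complex.exp ((x : ℂ) / 2 * Complex.exp w) * Complex.exp ((x : ℂ) / 2 * (Complex.exp w)⁻¹) =
      Complex.exp (x * Complex.cosh w) := by
    rw [← Complex.exp_add, Complex.cosh, ← Complex.exp_neg]
    ring_nf
  rw [h1] at h
  convert h using 2 with m
  rw [Complex.exp_int_mul]

/-- Summability of `m ↦ |I_m(x)| e^{m r}` (the generating series at the positive real point
`z = e^r`). [folklore] -/
theorem summable_abs_besselI_mul_exp (x r : ℝ) :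
    Summable fun m : ℤ => |besselI m x| * Real.exp (m * r) := by
  have h := hasSum_besselI_mul_exp |x| (r : ℂ)
  have h2 : (fun m : ℤ => (besselI m |x| : ℂ) * Complex.exp (m * (r : ℂ))) =
      fun m : ℤ => ((|besselI m x| * Real.exp (m * r) : ℝ) : ℂ) := by
    funext m
    rw [← abs_besselI]
    push_cast
    ring_nf
  rw [h2] at h
  have h3 : Complex.exp (↑|x| * Complex.cosh ↑r) = ((Real.exp (|x| * Real.cosh r) : ℝ) : ℂ) := by
    push_cast
    ring_nf
  rw [h3] at h
  exact (Complex.hasSum_ofReal.1 h).summable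

/-- Orthogonality of the characters on `[-π, π]`: `∫_{-π}^{π} e^{ikt} dt = 2π [k = 0]` for `k ∈ ℤ`.
[folklore] -/
theorem integral_cexp_int_mul_I (k : ℤ) :
    ∫ t in (-π)..π, Complex.exp (k * t * I) = if k = 0 then 2 * (π : ℂ) else 0 := by
  split_ifs with hk
  · subst hk
    simp
    ring
  · have hc : (k : ℂ) * I ≠ 0 := mul_ne_zero (by exact_mod_cast hk) Complex.I_ne_zero
    have h := integral_exp_mul_complex (a := -π) (b := π) hc
    have h' : (fun t : ℝ => Complex.exp (k * t * I)) = fun t : ℝ => Complex.exp (k * I * t) := by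
      funext t; ring_nf
    rw [h', h]
    have hper : Complex.exp (k * I * (π : ℝ)) = Complex.exp (k * I * (((-π : ℝ)) : ℂ)) := by
      rw [← mul_one (Complex.exp (↑k * I * ↑(-π))), ← Complex.exp_int_mul_two_pi_mul_I k,
        ← Complex.exp_add]
      congr 1
      push_cast
      ring
    rw [hper, sub_self, zero_div]

/-- **The shifted-contour representation of `I_n(x)`** (Fröhlich–Spencer (B.3)–(B.4), complex form):
for all real `x, r` and `n ∈ ℤ`, `∫_{-π}^{π} e^{x cosh(r+it)} e^{-int} dt = 2π e^{nr} I_n(x)`. In [FS81] this is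
obtained from `I_n(x) = (2π)⁻¹∫ e^{x cos θ} e^{inθ} dθ` by the change of variables `θ → θ + ir`
(Cauchy's theorem plus periodicity); here it is proved without complex analysis, by integrating the
absolutely convergent Laurent expansion `e^{x cosh(r+it)} = ∑_m I_m(x) e^{m(r+it)}` term by term
against `e^{-int}`. [cite: FrohlichSpencerKT1981, Appendix B, (B.1)–(B.4), pp. 597–598] -/
theorem integral_cexp_cosh_mul_cexp (x r : ℝ) (n : ℤ) :
    ∫ t in (-π)..π, Complex.exp (x * Complex.cosh (r + t * I)) * Complex.exp (-(n * t * I)) =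
      ((2 * π * Real.exp (n * r) * besselI n x : ℝ) : ℂ) := by
  set F : ℤ → ℝ → ℂ := fun m t =>
    (besselI m x : ℂ) * Complex.exp (m * (r + t * I)) * Complex.exp (-(n * t * I)) with hF
  have hsum : ∀ t : ℝ, HasSum (fun m => F m t)
      (Complex.exp (x * Complex.cosh (r + t * I)) * Complex.exp (-(n * t * I))) := fun t =>
    (hasSum_besselI_mul_exp x (r + t * I)).mul_right _
  have hbound : ∀ (m : ℤ) (t : ℝ), ‖F m t‖ ≤ |besselI m x| * Real.exp (m * r) := by
    intro m t
    simp only [hF, norm_mul, Complex.norm_real, Complex.norm_exp, Real.norm_eq_abs]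
    have h1 : ((m : ℂ) * (r + t * I)).re = m * r := by
      simp [Complex.mul_re]
    have h2 : (-((n : ℂ) * t * I)).re = 0 := by
      simp [Complex.mul_re]
    rw [h1, h2, Real.exp_zero, mul_one]
  have hcont : ∀ m : ℤ, Continuous (F m) := fun m => by
    simp only [hF]
    fun_prop
  have hint := intervalIntegral.hasSum_integral_of_dominated_convergence
      (fun (m : ℤ) (_ : ℝ) => |besselI m x| * Real.exp (m * r)) (F := F) (μ := volume) (a := -π)
      (b := π) (fun m => (hcont m).aestronglyMeasurable)
      (fun m => ae_of_all _ fun t _ => hbound m t)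
      (ae_of_all _ fun t _ => summable_abs_besselI_mul_exp x r)
      intervalIntegrable_const
      (ae_of_all _ fun t _ => hsum t)
  -- each term integrates to `I_m(x) e^{mr} ∫ e^{i(m-n)t} dt`
  have hFm : ∀ m : ℤ, ∫ t in (-π)..π, F m t =
      (besselI m x : ℂ) * Complex.exp (m * r) * (if m - n = 0 then 2 * (π : ℂ) else 0) := by
    intro m
    rw [← integral_cexp_int_mul_I (m - n), ← intervalIntegral.integral_const_mul]
    congr 1
    funext t
    simp only [hF]
    conv_lhs => rw [mul_assoc, ← Complex.exp_add]
    conv_rhs => rw [mul_assoc, ← Complex.exp_add]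
    congr 2
    push_cast
    ring
  have hFm' : (fun m : ℤ => ∫ t in (-π)..π, F m t) =
      fun m : ℤ => if m = n then ((2 * π * Real.exp (n * r) * besselI n x : ℝ) : ℂ) else 0 := by
    funext m
    rw [hFm m]
    by_cases h : m = n
    · subst h
      simp only [sub_self, if_true]
      push_cast
      ring
    · simp [sub_eq_zero, h]
  rw [hFm'] at hint
  exact hint.unique (hasSum_ite_eq n _)

/-- **The shifted-contour representation of `I_n(x)`** (real form): for all real `x, r` and
`n ∈ ℤ`, `I_n(x) = (e^{-nr}/2π) ∫_{-π}^{π} e^{x cosh r cos t} cos(x sinh r sin t - n t) dt`.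
[cite: FrohlichSpencerKT1981, Appendix B, (B.3)–(B.4), pp. 597–598] -/
theorem besselI_eq_integral_cosh (x r : ℝ) (n : ℤ) :
    besselI n x = Real.exp (-(n * r)) / (2 * π) *
      ∫ t in (-π)..π, Real.exp (x * Real.cosh r * Real.cos t) *
        Real.cos (x * Real.sinh r * Real.sin t - n * t) := by
  set f : ℝ → ℝ := fun t => Real.exp (x * Real.cosh r * Real.cos t) *
    Real.cos (x * Real.sinh r * Real.sin t - n * t) with hf
  set g : ℝ → ℝ := fun t => Real.exp (x * Real.cosh r * Real.cos t) *
    Real.sin (x * Real.sinh r * Real.sin t - n * t) with hg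
  have hpt : ∀ t : ℝ, Complex.exp (x * Complex.cosh (r + t * I)) * Complex.exp (-(n * t * I)) =
      (f t : ℂ) + (g t : ℂ) * I := by
    intro t
    rw [← Complex.exp_add, Complex.cosh_add, Complex.cosh_mul_I, Complex.sinh_mul_I]
    have : (x : ℂ) * (Complex.cosh r * Complex.cos t + Complex.sinh r * (Complex.sin t * I)) +
        -((n : ℂ) * t * I) = ((x * Real.cosh r * Real.cos t : ℝ) : ℂ) +
          ((x * Real.sinh r * Real.sin t - n * t : ℝ) : ℂ) * I := by
      push_cast
      ring
    rw [this, Complex.exp_add, Complex.exp_mul_I, hf, hg]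
    push_cast
    ring
  have hFc : Continuous fun t : ℝ =>
      Complex.exp (x * Complex.cosh (r + t * I)) * Complex.exp (-(n * t * I)) := by
    fun_prop
  have hmain := integral_cexp_cosh_mul_cexp x r n
  have hre := intervalIntegral.intervalIntegral_re (hFc.intervalIntegrable (-π) π) (μ := volume)
  rw [hmain] at hre
  simp only [RCLike.re_to_complex, Complex.ofReal_re] at hre
  have hre' : ∫ t in (-π)..π, f t = 2 * π * Real.exp (n * r) * besselI n x := by
    rw [← hre]
    refine intervalIntegral.integral_congr fun t _ => ?_
    simp only [hpt t, Complex.add_re, Complex.ofReal_re, Complex.mul_re, Complex.I_re, Complex.I_im,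
      Complex.ofReal_im, mul_zero, zero_mul, sub_zero, add_zero]
  rw [hre']
  have hπ : (2 : ℝ) * π ≠ 0 := by positivity
  rw [Real.exp_neg]
  field_simp

/-- **The saddle-point representation** (Fröhlich–Spencer (B.2)–(B.4)): for `x > 0` and `n ∈ ℤ`,
with `r = sinh⁻¹(n/x)` (so that `x sinh r = n`, `x cosh r = √(x²+n²)`),
`I_n(x) = (e^{-n sinh⁻¹(n/x)}/2π) ∫_{-π}^{π} e^{√(x²+n²) cos t} cos(n (sin t - t)) dt`.
[cite: FrohlichSpencerKT1981, Appendix B, (B.2)–(B.4), pp. 597–598] -/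
theorem besselI_eq_integral_saddle {x : ℝ} (hx : 0 < x) (n : ℤ) :
    besselI n x = Real.exp (-(n * Real.arsinh (n / x))) / (2 * π) *
      ∫ t in (-π)..π, Real.exp (√(x ^ 2 + n ^ 2) * Real.cos t) * Real.cos (n * (Real.sin t - t)) := by
  have h := besselI_eq_integral_cosh x (Real.arsinh (n / x)) n
  have h1 : x * Real.sinh (Real.arsinh (n / x)) = n := by
    rw [Real.sinh_arsinh]; field_simp
  have h2 : x * Real.cosh (Real.arsinh (n / x)) = √(x ^ 2 + n ^ 2) := by
    rw [Real.cosh_arsinh]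
    have : (1 : ℝ) + (n / x) ^ 2 = (x ^ 2 + n ^ 2) / x ^ 2 := by
      field_simp
    rw [this, Real.sqrt_div' _ (sq_nonneg x), Real.sqrt_sq hx.le]
    field_simp
  rw [h1, h2] at h
  rw [h]
  congr 1
  refine intervalIntegral.integral_congr fun t _ => ?_
  congr 2
  ring

/-! ### Elementary inequalities for the Laplace method -/

/-- `cos t ≤ 1 - t²/2 + t⁴/24` for all real `t`. [folklore] -/
theorem cos_le_one_sub_sq_half_add_fourth (t : ℝ) : Real.cos t ≤ 1 - t ^ 2 / 2 + t ^ 4 / 24 := by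
  wlog ht : 0 ≤ t
  · have h := this (-t) (by linarith)
    have h4 : (-t) ^ 4 = t ^ 4 := by ring
    simpa [Real.cos_neg, h4] using h
  let f (u : ℝ) : ℝ := 1 - u ^ 2 / 2 + u ^ 4 / 24 - Real.cos u
  have hderiv (u : ℝ) : deriv f u = Real.sin u - (u - u ^ 3 / 6) := by
    simp (disch := fun_prop) [f]
    ring
  have hmono : MonotoneOn f (Set.Ici 0) := by
    apply monotoneOn_of_deriv_nonneg (convex_Ici 0) (by fun_prop) (by fun_prop)
    intro u hu
    rw [interior_Ici] at hu
    rw [hderiv]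
    linarith [Real.sin_ge_sub_cube (le_of_lt hu)]
  have h0 : f 0 ≤ f t := hmono (by simp) ht ht
  simp only [f, Real.cos_zero] at h0
  linarith

/-- `uᵏ e^{-u} ≤ kᵏ e^{-k}` for `u ≥ 0` (the maximum of `uᵏe^{-u}` is at `u = k`). [folklore] -/
theorem pow_mul_exp_neg_le {k : ℕ} (hk : k ≠ 0) {u : ℝ} (hu : 0 ≤ u) :
    u ^ k * Real.exp (-u) ≤ (k : ℝ) ^ k * Real.exp (-k) := by
  have hk' : (0 : ℝ) < k := by exact_mod_cast Nat.pos_of_ne_zero hk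
  have h1 : u / k ≤ Real.exp (u / k - 1) := by linarith [Real.add_one_le_exp (u / k - 1)]
  have h2 : (u / k) ^ k ≤ Real.exp (u / k - 1) ^ k := by gcongr
  rw [← Real.exp_nat_mul, div_pow] at h2
  have h3 : (k : ℝ) * (u / k - 1) = u - k := by field_simp
  rw [h3, div_le_iff₀ (by positivity)] at h2
  -- h2 : u ^ k ≤ exp (u - k) * k ^ k
  have h4 : Real.exp (u - k) * (k : ℝ) ^ k * Real.exp (-u) = (k : ℝ) ^ k * Real.exp (-k) := by
    rw [mul_comm (Real.exp _), mul_assoc, ← Real.exp_add]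
    ring_nf
  calc u ^ k * Real.exp (-u) ≤ Real.exp (u - k) * (k : ℝ) ^ k * Real.exp (-u) := by gcongr
    _ = (k : ℝ) ^ k * Real.exp (-k) := h4

/-! ### The pointwise Laplace bound -/

/-- Pointwise comparison of the saddle-point integrand with the Gaussian: for `|t| ≤ π`, `s ≥ 0` and
`n² ≤ s²`,
`|e^{-s(1-cos t)} cos(n(sin t - t)) - e^{-st²/2}| ≤ (st⁴/24 + s²t⁶/72) e^{-(2/π²)st²}`.
Ingredients: `1 - cos t ≥ (2/π²)t²` on `[-π, π]`, `0 ≤ cos t - 1 + t²/2 ≤ t⁴/24`,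
`|sin t - t| ≤ |t|³/6`, `1 - cos B ≤ B²/2`. [cite: FrohlichSpencerKT1981, Appendix B, (B.6)–(B.10), p. 598] -/
theorem laplace_pointwise {s : ℝ} (hs : 0 ≤ s) {n : ℤ} (hn : (n : ℝ) ^ 2 ≤ s ^ 2) {t : ℝ}
    (ht : |t| ≤ π) :
    |Real.exp (-(s * (1 - Real.cos t))) * Real.cos (n * (Real.sin t - t)) - Real.exp (-(s * t ^ 2 / 2))|
      ≤ (s * t ^ 4 / 24 + s ^ 2 * t ^ 6 / 72) * Real.exp (-(2 / π ^ 2 * s * t ^ 2)) := by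
  set a := s * (1 - Real.cos t) with ha
  set b := s * t ^ 2 / 2 with hb
  set c := 2 / π ^ 2 * s * t ^ 2 with hc
  set B := (n : ℝ) * (Real.sin t - t) with hB
  have hπ : (2 : ℝ) ≤ π := Real.two_le_pi
  have hcos := Real.cos_le_one_sub_mul_cos_sq ht
  have hca : c ≤ a := by
    rw [hc, ha]
    have : 2 / π ^ 2 * t ^ 2 ≤ 1 - Real.cos t := by linarith
    calc 2 / π ^ 2 * s * t ^ 2 = s * (2 / π ^ 2 * t ^ 2) := by ring
      _ ≤ s * (1 - Real.cos t) := by gcongr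
  have hcb : c ≤ b := by
    rw [hc, hb]
    have h4 : (2 : ℝ) / π ^ 2 ≤ 1 / 2 := by
      rw [div_le_div_iff₀ (by positivity) (by norm_num)]
      nlinarith
    have : 2 / π ^ 2 * s * t ^ 2 = (2 / π ^ 2) * (s * t ^ 2) := by ring
    rw [this]
    calc (2 / π ^ 2) * (s * t ^ 2) ≤ (1 / 2) * (s * t ^ 2) := by gcongr
      _ = s * t ^ 2 / 2 := by ring
  have hba0 : 0 ≤ b - a := by
    have h1 : b - a = s * (Real.cos t - 1 + t ^ 2 / 2) := by rw [ha, hb]; ring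
    have h2 : 0 ≤ Real.cos t - 1 + t ^ 2 / 2 := by linarith [Real.one_sub_sq_div_two_le_cos (x := t)]
    rw [h1]; positivity
  have hba : b - a ≤ s * t ^ 4 / 24 := by
    have h1 : b - a = s * (Real.cos t - 1 + t ^ 2 / 2) := by rw [ha, hb]; ring
    have h3 : Real.cos t - 1 + t ^ 2 / 2 ≤ t ^ 4 / 24 := by
      linarith [cos_le_one_sub_sq_half_add_fourth t]
    rw [h1]
    calc s * (Real.cos t - 1 + t ^ 2 / 2) ≤ s * (t ^ 4 / 24) := by gcongr
      _ = s * t ^ 4 / 24 := by ring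
  -- `|e^{-a} - e^{-b}| = e^{-a}(1 - e^{-(b-a)}) ≤ e^{-a}(b - a) ≤ e^{-c} · st⁴/24`
  have hab : |Real.exp (-a) - Real.exp (-b)| ≤ s * t ^ 4 / 24 * Real.exp (-c) := by
    have h1 : Real.exp (-b) ≤ Real.exp (-a) := Real.exp_le_exp.2 (by linarith)
    have h2 : Real.exp (-a) - Real.exp (-b) = Real.exp (-a) * (1 - Real.exp (-(b - a))) := by
      rw [mul_sub, mul_one, ← Real.exp_add]
      ring_nf
    have h3 : 1 - Real.exp (-(b - a)) ≤ b - a := by linarith [Real.add_one_le_exp (-(b - a))]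
    have h4 : Real.exp (-a) ≤ Real.exp (-c) := Real.exp_le_exp.2 (by linarith)
    rw [abs_of_nonneg (by linarith), h2]
    calc Real.exp (-a) * (1 - Real.exp (-(b - a)))
        ≤ Real.exp (-a) * (b - a) := by gcongr
      _ ≤ Real.exp (-c) * (s * t ^ 4 / 24) := by gcongr
      _ = s * t ^ 4 / 24 * Real.exp (-c) := by ring
  have hBsq : B ^ 2 ≤ s ^ 2 * t ^ 6 / 36 := by
    have h1 : |B| ≤ |(n : ℝ)| * (|t| ^ 3 / 6) := by
      rw [hB, abs_mul]
      gcongr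
      rw [abs_sub_comm]
      exact Real.abs_sub_sin_le t
    have h2 : B ^ 2 = |B| ^ 2 := (sq_abs B).symm
    have h3 : |(n : ℝ)| ^ 2 ≤ s ^ 2 := by rwa [sq_abs]
    have h4 : (|t| ^ 3 / 6) ^ 2 = t ^ 6 / 36 := by
      rw [div_pow, ← pow_mul, show (3 * 2 : ℕ) = 6 by norm_num]
      have : |t| ^ 6 = t ^ 6 := by
        rw [show (6 : ℕ) = 2 * 3 by norm_num, pow_mul, pow_mul, sq_abs]
      rw [this]; norm_num
    calc B ^ 2 = |B| ^ 2 := h2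
      _ ≤ (|(n : ℝ)| * (|t| ^ 3 / 6)) ^ 2 := by gcongr
      _ = |(n : ℝ)| ^ 2 * (|t| ^ 3 / 6) ^ 2 := by ring
      _ ≤ s ^ 2 * (|t| ^ 3 / 6) ^ 2 := by gcongr
      _ = s ^ 2 * t ^ 6 / 36 := by rw [h4]; ring
  have hcosB : |Real.cos B - 1| ≤ s ^ 2 * t ^ 6 / 72 := by
    rw [abs_sub_comm, abs_of_nonneg (by linarith [Real.cos_le_one B])]
    linarith [Real.one_sub_sq_div_two_le_cos (x := B)]
  have hsplit : Real.exp (-a) * Real.cos B - Real.exp (-b) =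
      (Real.exp (-a) - Real.exp (-b)) * Real.cos B + Real.exp (-b) * (Real.cos B - 1) := by ring
  have heb : Real.exp (-b) ≤ Real.exp (-c) := Real.exp_le_exp.2 (by linarith)
  calc |Real.exp (-a) * Real.cos B - Real.exp (-b)|
      = |(Real.exp (-a) - Real.exp (-b)) * Real.cos B + Real.exp (-b) * (Real.cos B - 1)| := by
        rw [hsplit]
    _ ≤ |(Real.exp (-a) - Real.exp (-b)) * Real.cos B| + |Real.exp (-b) * (Real.cos B - 1)| :=
        abs_add_le _ _
    _ = |Real.exp (-a) - Real.exp (-b)| * |Real.cos B| + Real.exp (-b) * |Real.cos B - 1| := by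
        rw [abs_mul, abs_mul, abs_of_pos (Real.exp_pos _)]
    _ ≤ (s * t ^ 4 / 24 * Real.exp (-c)) * 1 + Real.exp (-c) * (s ^ 2 * t ^ 6 / 72) := by
        gcongr
        exact Real.abs_cos_le_one B
    _ = (s * t ^ 4 / 24 + s ^ 2 * t ^ 6 / 72) * Real.exp (-c) := by ring

/-- The error integrand is dominated by a Gaussian of half the rate, uniformly in `s > 0`:
`(st⁴/24 + s²t⁶/72) e^{-(2/π²)st²} ≤ (M/s) e^{-(1/π²)st²}` with
`M = π⁴e^{-2}/6 + 3π⁶e^{-3}/8` (from `u²e^{-u} ≤ 4e^{-2}`, `u³e^{-u} ≤ 27e^{-3}`, `u = st²/π²`). [folklore] -/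
theorem laplace_error_integrand_le {s : ℝ} (hs : 0 < s) (t : ℝ) :
    (s * t ^ 4 / 24 + s ^ 2 * t ^ 6 / 72) * Real.exp (-(2 / π ^ 2 * s * t ^ 2)) ≤
      (π ^ 4 / 6 * Real.exp (-2) + 3 * π ^ 6 / 8 * Real.exp (-3)) / s *
        Real.exp (-(1 / π ^ 2 * s * t ^ 2)) := by
  have hπ : 0 < π := Real.pi_pos
  set u := 1 / π ^ 2 * s * t ^ 2 with hu_def
  have hu : 0 ≤ u := by positivity
  have ht2 : t ^ 2 = π ^ 2 * u / s := by
    rw [hu_def]; field_simp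
  have ht4 : s * t ^ 4 / 24 = π ^ 4 / (24 * s) * u ^ 2 := by
    rw [show t ^ 4 = (t ^ 2) ^ 2 by ring, ht2]; field_simp
  have ht6 : s ^ 2 * t ^ 6 / 72 = π ^ 6 / (72 * s) * u ^ 3 := by
    rw [show t ^ 6 = (t ^ 2) ^ 3 by ring, ht2]; field_simp
  have hexp : Real.exp (-(2 / π ^ 2 * s * t ^ 2)) = Real.exp (-u) * Real.exp (-u) := by
    rw [← Real.exp_add, hu_def]; congr 1; ring
  have hexp' : Real.exp (-(1 / π ^ 2 * s * t ^ 2)) = Real.exp (-u) := by rw [hu_def]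
  have h2 := pow_mul_exp_neg_le (k := 2) (by norm_num) hu
  have h3 := pow_mul_exp_neg_le (k := 3) (by norm_num) hu
  norm_num at h2 h3
  rw [ht4, ht6, hexp, hexp']
  have hpos : 0 < Real.exp (-u) := Real.exp_pos _
  calc (π ^ 4 / (24 * s) * u ^ 2 + π ^ 6 / (72 * s) * u ^ 3) * (Real.exp (-u) * Real.exp (-u))
      = (π ^ 4 / (24 * s) * (u ^ 2 * Real.exp (-u)) + π ^ 6 / (72 * s) * (u ^ 3 * Real.exp (-u))) *
          Real.exp (-u) := by ring
    _ ≤ (π ^ 4 / (24 * s) * (4 * Real.exp (-2)) + π ^ 6 / (72 * s) * (27 * Real.exp (-3))) *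
          Real.exp (-u) := by gcongr
    _ = (π ^ 4 / 6 * Real.exp (-2) + 3 * π ^ 6 / 8 * Real.exp (-3)) / s * Real.exp (-u) := by
          field_simp; ring

/-! ### Gaussian integrals over `[-π, π]` -/

/-- `∫_{-π}^{π} e^{-bt²} dt ≤ √(π/b)` for `b > 0`. [folklore] -/
theorem intervalIntegral_exp_neg_mul_sq_le {b : ℝ} (hb : 0 < b) :
    ∫ t in (-π)..π, Real.exp (-b * t ^ 2) ≤ √(π / b) := by
  rw [intervalIntegral.integral_of_le (by linarith [Real.pi_pos]), ← integral_gaussian b]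
  exact setIntegral_le_integral (integrable_exp_neg_mul_sq hb)
    (Filter.Eventually.of_forall fun t => (Real.exp_pos _).le)

/-- The Gaussian tail beyond `[-π, π]`:
`√(2π/s) - e^{-sπ²/4} √(4π/s) ≤ ∫_{-π}^{π} e^{-st²/2} dt`. [folklore] -/
theorem sub_le_intervalIntegral_exp_neg_half_mul_sq {s : ℝ} (hs : 0 < s) :
    √(2 * π / s) - Real.exp (-(s * π ^ 2 / 4)) * √(4 * π / s) ≤
      ∫ t in (-π)..π, Real.exp (-(s * t ^ 2 / 2)) := by
  have hπ : 0 < π := Real.pi_pos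
  set f : ℝ → ℝ := fun t => Real.exp (-(s / 2) * t ^ 2) with hf_def
  have hf : Integrable f := integrable_exp_neg_mul_sq (by positivity)
  have hgauss : ∫ t, f t = √(2 * π / s) := by
    rw [hf_def, integral_gaussian]
    congr 1
    field_simp
  have hsplit := integral_add_compl (measurableSet_Ioc (a := -π) (b := π)) hf
  set g : ℝ → ℝ := fun t => Real.exp (-(s * π ^ 2 / 4)) * Real.exp (-(s / 4) * t ^ 2) with hg_def
  have hg : Integrable g := (integrable_exp_neg_mul_sq (by positivity)).const_mul _
  have hgauss' : ∫ t, g t = Real.exp (-(s * π ^ 2 / 4)) * √(4 * π / s) := by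
    rw [hg_def, MeasureTheory.integral_const_mul, integral_gaussian]
    congr 2
    field_simp
  have htail : ∫ t in (Set.Ioc (-π) π)ᶜ, f t ≤ Real.exp (-(s * π ^ 2 / 4)) * √(4 * π / s) := by
    calc ∫ t in (Set.Ioc (-π) π)ᶜ, f t ≤ ∫ t in (Set.Ioc (-π) π)ᶜ, g t := by
          apply setIntegral_mono_on hf.integrableOn hg.integrableOn (measurableSet_Ioc.compl)
          intro t ht
          have ht' : π ^ 2 ≤ t ^ 2 := by
            simp only [Set.mem_compl_iff, Set.mem_Ioc, not_and_or, not_lt, not_le] at ht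
            rcases ht with h | h
            · nlinarith
            · nlinarith
          simp only [hf_def, hg_def]
          rw [← Real.exp_add]
          apply Real.exp_le_exp.2
          nlinarith
      _ ≤ ∫ t, g t := setIntegral_le_integral hg
          (Filter.Eventually.of_forall fun t => by simp only [hg_def]; positivity)
      _ = Real.exp (-(s * π ^ 2 / 4)) * √(4 * π / s) := hgauss'
  rw [intervalIntegral.integral_of_le (by linarith)]
  have hfeq : (fun t => Real.exp (-(s * t ^ 2 / 2))) = f := by
    funext t; simp only [hf_def]; congr 1; ring
  rw [hfeq]
  linarith

/-- Upper bound: `∫_{-π}^{π} e^{-st²/2} dt ≤ √(2π/s)`. [folklore] -/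
theorem intervalIntegral_exp_neg_half_mul_sq_le {s : ℝ} (hs : 0 < s) :
    ∫ t in (-π)..π, Real.exp (-(s * t ^ 2 / 2)) ≤ √(2 * π / s) := by
  have h := intervalIntegral_exp_neg_mul_sq_le (b := s / 2) (by positivity)
  have hfeq : (fun t => Real.exp (-(s * t ^ 2 / 2))) = fun t => Real.exp (-(s / 2) * t ^ 2) := by
    funext t; congr 1; ring
  have h2 : √(π / (s / 2)) = √(2 * π / s) := by congr 1; field_simp
  rw [hfeq, ← h2]
  exact h

/-! ### The numerical constant -/

/-- The constant of the Laplace estimate: `(π⁴e^{-2}/6 + 3π⁶e^{-3}/8)·π√π + 8/(π√π) ≤ 125`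
(numerically `≈ 113.6`). [folklore] -/
theorem laplace_constant_le :
    (π ^ 4 / 6 * Real.exp (-2) + 3 * π ^ 6 / 8 * Real.exp (-3)) * (π * √π) + 8 / (π * √π) ≤ 125 := by
  have hπ1 : π < 3.15 := Real.pi_lt_d2
  have hπ2 : 3 < π := Real.pi_gt_three
  have hπ0 : 0 < π := Real.pi_pos
  have hsq1 : √π < 1.775 := by
    rw [Real.sqrt_lt' (by norm_num)]; nlinarith
  have hsq2 : 1.7 < √π := by
    rw [Real.lt_sqrt (by norm_num)]; nlinarith
  have he : 2.7182818283 < Real.exp 1 := Real.exp_one_gt_d9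
  have he0 : 0 < Real.exp 1 := Real.exp_pos 1
  have he2 : Real.exp (-2) ≤ 0.1354 := by
    have h1 : Real.exp (-2) = (Real.exp 1 ^ 2)⁻¹ := by
      rw [← Real.exp_nat_mul, ← Real.exp_neg]; norm_num
    rw [h1, inv_le_comm₀ (by positivity) (by norm_num)]
    nlinarith
  have he3 : Real.exp (-3) ≤ 0.0499 := by
    have h1 : Real.exp (-3) = (Real.exp 1 ^ 3)⁻¹ := by
      rw [← Real.exp_nat_mul, ← Real.exp_neg]; norm_num
    rw [h1, inv_le_comm₀ (by positivity) (by norm_num)]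
    have h2 : (2.7182818283 : ℝ) ^ 3 ≤ Real.exp 1 ^ 3 := by gcongr
    nlinarith
  have hp4 : π ^ 4 ≤ 3.15 ^ 4 := by gcongr
  have hp6 : π ^ 6 ≤ 3.15 ^ 6 := by gcongr
  have hps : π * √π ≤ 3.15 * 1.775 := by gcongr
  have hps' : (5.1 : ℝ) ≤ π * √π := by nlinarith
  calc (π ^ 4 / 6 * Real.exp (-2) + 3 * π ^ 6 / 8 * Real.exp (-3)) * (π * √π) + 8 / (π * √π)
      ≤ ((3.15 : ℝ) ^ 4 / 6 * 0.1354 + 3 * (3.15 : ℝ) ^ 6 / 8 * 0.0499) * (3.15 * 1.775) + 8 / 5.1 := by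
        gcongr
    _ ≤ 125 := by norm_num

/-! ### The Laplace estimate -/

/-- `√(π³) = π √π`. [folklore] -/
theorem sqrt_pi_cube : √(π ^ 3) = π * √π := by
  rw [show π ^ 3 = π ^ 2 * π by ring, Real.sqrt_mul (sq_nonneg π), Real.sqrt_sq Real.pi_pos.le]

/-- **The Laplace (steepest descent) estimate with explicit constant**: for `s > 0` and `n ∈ ℤ`
with `n² ≤ s²`,
`|∫_{-π}^{π} e^{-s(1-cos t)} cos(n(sin t - t)) dt - √(2π/s)| ≤ 125 / (s√s)`.
This is (B.7)–(B.11) of [FS81] (there with an unspecified `O(σ⁻²)`, `σ² = s`).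
[cite: FrohlichSpencerKT1981, Appendix B, (B.4)–(B.11), p. 598] -/
theorem laplace_estimate {s : ℝ} (hs : 0 < s) {n : ℤ} (hn : (n : ℝ) ^ 2 ≤ s ^ 2) :
    |(∫ t in (-π)..π, Real.exp (-(s * (1 - Real.cos t))) * Real.cos (n * (Real.sin t - t))) -
        √(2 * π / s)| ≤ 125 / (s * √s) := by
  have hπ : 0 < π := Real.pi_pos
  have hsq : 0 < √s := Real.sqrt_pos.2 hs
  have hsqπ : 0 < √π := Real.sqrt_pos.2 hπ
  set M := π ^ 4 / 6 * Real.exp (-2) + 3 * π ^ 6 / 8 * Real.exp (-3) with hM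
  have hM0 : 0 ≤ M := by positivity
  set φ : ℝ → ℝ := fun t => Real.exp (-(s * (1 - Real.cos t))) * Real.cos (n * (Real.sin t - t))
    with hφ
  set g : ℝ → ℝ := fun t => Real.exp (-(s * t ^ 2 / 2)) with hg
  have hφc : Continuous φ := by simp only [hφ]; fun_prop
  have hgc : Continuous g := by simp only [hg]; fun_prop
  -- Step 1: the non-Gaussian error
  have h1 : |(∫ t in (-π)..π, φ t) - ∫ t in (-π)..π, g t| ≤ M / s * (π * √π / √s) := by
    rw [← intervalIntegral.integral_sub (hφc.intervalIntegrable _ _) (hgc.intervalIntegrable _ _)]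
    have hbc : Continuous fun t : ℝ => M / s * Real.exp (-(1 / π ^ 2 * s) * t ^ 2) := by fun_prop
    have hb : ‖∫ t in (-π)..π, (φ t - g t)‖ ≤
        ∫ t in (-π)..π, M / s * Real.exp (-(1 / π ^ 2 * s) * t ^ 2) := by
      apply intervalIntegral.norm_integral_le_of_norm_le (by linarith) _ (hbc.intervalIntegrable _ _)
      refine Filter.Eventually.of_forall fun t ht => ?_
      have ht' : |t| ≤ π := abs_le.2 ⟨by linarith [ht.1], ht.2⟩
      rw [Real.norm_eq_abs]
      calc |φ t - g t|
          ≤ (s * t ^ 4 / 24 + s ^ 2 * t ^ 6 / 72) * Real.exp (-(2 / π ^ 2 * s * t ^ 2)) :=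
            laplace_pointwise hs.le hn ht'
        _ ≤ M / s * Real.exp (-(1 / π ^ 2 * s * t ^ 2)) := laplace_error_integrand_le hs t
        _ = M / s * Real.exp (-(1 / π ^ 2 * s) * t ^ 2) := by congr 2; ring
    rw [Real.norm_eq_abs] at hb
    calc |∫ t in (-π)..π, (φ t - g t)|
        ≤ ∫ t in (-π)..π, M / s * Real.exp (-(1 / π ^ 2 * s) * t ^ 2) := hb
      _ = M / s * ∫ t in (-π)..π, Real.exp (-(1 / π ^ 2 * s) * t ^ 2) :=
          intervalIntegral.integral_const_mul _ _
      _ ≤ M / s * √(π / (1 / π ^ 2 * s)) := by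
          gcongr
          exact intervalIntegral_exp_neg_mul_sq_le (by positivity)
      _ = M / s * (π * √π / √s) := by
          congr 1
          rw [show π / (1 / π ^ 2 * s) = π ^ 3 / s by field_simp, Real.sqrt_div' _ hs.le,
            sqrt_pi_cube]
  -- Step 2: the Gaussian tail
  have h2 : |(∫ t in (-π)..π, g t) - √(2 * π / s)| ≤ 8 / (π * √π) / (s * √s) := by
    have hlo := sub_le_intervalIntegral_exp_neg_half_mul_sq hs
    have hhi := intervalIntegral_exp_neg_half_mul_sq_le hs
    have htail : Real.exp (-(s * π ^ 2 / 4)) * √(4 * π / s) ≤ 8 / (π * √π) / (s * √s) := by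
      have he : Real.exp (-(s * π ^ 2 / 4)) ≤ 4 / (π ^ 2 * s) := by
        rw [Real.exp_neg, inv_eq_one_div, div_le_div_iff₀ (Real.exp_pos _) (by positivity), one_mul]
        nlinarith [Real.add_one_le_exp (s * π ^ 2 / 4)]
      have hsq4 : √(4 * π / s) = 2 * √π / √s := by
        rw [Real.sqrt_div' _ hs.le, Real.sqrt_mul (by norm_num), show (4 : ℝ) = 2 ^ 2 by norm_num,
          Real.sqrt_sq (by norm_num)]
      have hππ : √π * √π = π := Real.mul_self_sqrt hπ.le
      have hss : √s * √s = s := Real.mul_self_sqrt hs.le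
      calc Real.exp (-(s * π ^ 2 / 4)) * √(4 * π / s) ≤ 4 / (π ^ 2 * s) * √(4 * π / s) := by gcongr
        _ = 8 / (π * √π) / (s * √s) := by
            rw [hsq4]
            field_simp
            nlinarith [hππ, hss]
    rw [abs_sub_le_iff]
    constructor
    · have : (0 : ℝ) ≤ 8 / (π * √π) / (s * √s) := by positivity
      linarith
    · linarith
  -- combine
  have hcomb : M / s * (π * √π / √s) + 8 / (π * √π) / (s * √s) =
      (M * (π * √π) + 8 / (π * √π)) / (s * √s) := by
    field_simp
  calc |(∫ t in (-π)..π, φ t) - √(2 * π / s)|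
      ≤ |(∫ t in (-π)..π, φ t) - ∫ t in (-π)..π, g t| + |(∫ t in (-π)..π, g t) - √(2 * π / s)| :=
        abs_sub_le _ _ _
    _ ≤ M / s * (π * √π / √s) + 8 / (π * √π) / (s * √s) := add_le_add h1 h2
    _ = (M * (π * √π) + 8 / (π * √π)) / (s * √s) := hcomb
    _ ≤ 125 / (s * √s) := by
        gcongr
        exact laplace_constant_le

/-! ### Fröhlich–Spencer (B.12): uniform leading-order Debye asymptotics at integer order -/

/-- **Uniform Debye asymptotics of `I_n(x)` at integer order, with an explicit constant**
(Fröhlich–Spencer [FS81, (B.11)–(B.12)]: `I_β(n) = L_β(n)(1 + O(σ⁻²))` for all `n ∈ ℤ`, where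
`L_β(n) = (2π)^{-1/2} (β² + n²)^{-1/4} exp[(β² + n²)^{1/2} - n sinh⁻¹(n/β)]` and `σ² = (β² + n²)^{1/2}`).
Precisely: for every `x > 0` and `n ∈ ℤ`,
`|I_n(x) · √(2π √(x²+n²)) · e^{n sinh⁻¹(n/x) - √(x²+n²)} - 1| ≤ 50 / √(x²+n²)`;
in particular the relative error is `≤ 50/x` uniformly in `n ∈ ℤ`. This is the one analytic input of
the interpolation `I_β(φ) = L_β(φ)E_β(φ)` of [FS81, Appendix B] used for the plane rotator
(Sect. 6 of [FS81]) and for the Wilson-action `U(1)` lattice gauge theory ([FS82, p. 433]).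
[cite: FrohlichSpencerKT1981, Appendix B, (B.11)–(B.12), pp. 598–599] -/
theorem abs_besselI_mul_debye_sub_one_le {x : ℝ} (hx : 0 < x) (n : ℤ) :
    |besselI n x * (√(2 * π * √(x ^ 2 + n ^ 2)) *
        Real.exp (n * Real.arsinh (n / x) - √(x ^ 2 + n ^ 2))) - 1| ≤ 50 / √(x ^ 2 + n ^ 2) := by
  have hπ : 0 < π := Real.pi_pos
  set s := √(x ^ 2 + n ^ 2) with hs_def
  have hs : 0 < s := Real.sqrt_pos.2 (by positivity)
  have hsq : 0 < √s := Real.sqrt_pos.2 hs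
  have hs2 : s ^ 2 = x ^ 2 + n ^ 2 := Real.sq_sqrt (by positivity)
  have hn : (n : ℝ) ^ 2 ≤ s ^ 2 := by rw [hs2]; nlinarith
  set r := Real.arsinh (n / x) with hr_def
  set J := ∫ t in (-π)..π, Real.exp (-(s * (1 - Real.cos t))) * Real.cos (n * (Real.sin t - t))
    with hJ
  have hrep : besselI n x = Real.exp (-(n * r)) / (2 * π) * (Real.exp s * J) := by
    rw [besselI_eq_integral_saddle hx n, hJ,
      ← intervalIntegral.integral_const_mul (Real.exp s)
        (fun t => Real.exp (-(s * (1 - Real.cos t))) * Real.cos (n * (Real.sin t - t)))]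
    congr 1
    refine intervalIntegral.integral_congr fun t _ => ?_
    rw [← mul_assoc, ← Real.exp_add]
    congr 2
    ring
  have hlap : |J - √(2 * π / s)| ≤ 125 / (s * √s) := laplace_estimate hs hn
  -- algebra: the quantity of interest is `(J - √(2π/s)) · √s/√(2π)`
  have h2π : 0 < √(2 * π) := Real.sqrt_pos.2 (by positivity)
  have hss : √s * √s = s := Real.mul_self_sqrt hs.le
  have h2π2 : √(2 * π) * √(2 * π) = 2 * π := Real.mul_self_sqrt (by positivity)
  have hexp : Real.exp (-(n * r)) * Real.exp s * Real.exp (n * r - s) = 1 := by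
    rw [← Real.exp_add, ← Real.exp_add, ← Real.exp_zero]
    congr 1; ring
  have hL : besselI n x * (√(2 * π * s) * Real.exp (n * r - s)) - 1 = J * √s / √(2 * π) - 1 := by
    rw [hrep, Real.sqrt_mul (by positivity) s]
    have : Real.exp (-(n * r)) / (2 * π) * (Real.exp s * J) * (√(2 * π) * √s * Real.exp (n * r - s)) =
        (Real.exp (-(n * r)) * Real.exp s * Real.exp (n * r - s)) * J * (√(2 * π) * √s) / (2 * π) := by
      ring
    rw [this, hexp, one_mul, sub_left_inj, div_eq_div_iff (by positivity) (by positivity)]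
    calc J * (√(2 * π) * √s) * √(2 * π) = J * √s * (√(2 * π) * √(2 * π)) := by ring
      _ = J * √s * (2 * π) := by rw [h2π2]
  have hR : (J - √(2 * π / s)) * (√s / √(2 * π)) = J * √s / √(2 * π) - 1 := by
    rw [Real.sqrt_div' _ hs.le]
    field_simp
  have hkey : besselI n x * (√(2 * π * s) * Real.exp (n * r - s)) - 1 =
      (J - √(2 * π / s)) * (√s / √(2 * π)) := by rw [hL, hR]
  have h25 : (2.5 : ℝ) ≤ √(2 * π) := by
    apply Real.le_sqrt_of_sq_le
    nlinarith [Real.pi_gt_d2]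
  rw [hkey, abs_mul, abs_of_pos (by positivity : 0 < √s / √(2 * π))]
  calc |J - √(2 * π / s)| * (√s / √(2 * π)) ≤ 125 / (s * √s) * (√s / √(2 * π)) := by gcongr
    _ = 125 / √(2 * π) / s := by field_simp
    _ ≤ 125 / 2.5 / s := by gcongr
    _ = 50 / s := by norm_num

/-- **Two-sided form of (B.12)**: for `x > 0` and `n ∈ ℤ`, with `s = √(x²+n²)` and `r = sinh⁻¹(n/x)`,
`(1 - 50/s) · e^{s - nr}/√(2πs) ≤ I_n(x) ≤ (1 + 50/s) · e^{s - nr}/√(2πs)`.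
[cite: FrohlichSpencerKT1981, Appendix B, (B.11)–(B.12), pp. 598–599] -/
theorem besselI_mem_Icc_debye {x : ℝ} (hx : 0 < x) (n : ℤ) :
    besselI n x ∈ Set.Icc
      ((1 - 50 / √(x ^ 2 + n ^ 2)) * (Real.exp (√(x ^ 2 + n ^ 2) - n * Real.arsinh (n / x)) /
        √(2 * π * √(x ^ 2 + n ^ 2))))
      ((1 + 50 / √(x ^ 2 + n ^ 2)) * (Real.exp (√(x ^ 2 + n ^ 2) - n * Real.arsinh (n / x)) /
        √(2 * π * √(x ^ 2 + n ^ 2)))) := by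
  have h := abs_besselI_mul_debye_sub_one_le hx n
  set s := √(x ^ 2 + n ^ 2) with hs_def
  set r := Real.arsinh (n / x)
  have hs : 0 < s := Real.sqrt_pos.2 (by positivity)
  have hL : 0 < √(2 * π * s) * Real.exp (n * r - s) := by positivity
  have hid : Real.exp (s - n * r) / √(2 * π * s) = (√(2 * π * s) * Real.exp (n * r - s))⁻¹ := by
    rw [mul_inv, ← Real.exp_neg, neg_sub, div_eq_mul_inv, mul_comm]
  rw [hid]
  rw [abs_le] at h
  constructor
  · rw [mul_inv_le_iff₀ hL]
    linarith [h.1]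
  · rw [le_mul_inv_iff₀ hL]
    linarith [h.2]

/-- `|y - 1| ≤ ε ≤ 1/2` implies `|log y| ≤ 2ε`. [folklore] -/
theorem abs_log_le_of_abs_sub_one_le {y ε : ℝ} (h : |y - 1| ≤ ε) (hε : ε ≤ 1 / 2) :
    |Real.log y| ≤ 2 * ε := by
  rw [abs_le] at h
  have hy : 1 / 2 ≤ y := by linarith [h.1]
  have hy0 : 0 < y := by linarith
  rw [abs_le]
  constructor
  · have h1 := Real.one_sub_inv_le_log_of_pos hy0
    have h2 : y⁻¹ ≤ 1 + 2 * ε := by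
      rw [inv_le_comm₀ hy0 (by linarith [h.1, hy])]
      -- (1 + 2ε)⁻¹ ≤ y since y ≥ 1 - ε ≥ (1+2ε)⁻¹  ⇐ (1 - ε)(1 + 2ε) ≥ 1 ⇐ ε - 2ε² ≥ 0
      rw [inv_le_comm₀ (by linarith [h.1, hy]) hy0, inv_le_comm₀ hy0 (by linarith [h.1, hy])]
      have hε0 : 0 ≤ ε := by linarith [h.1, h.2]
      rw [inv_eq_one_div, div_le_iff₀ (by linarith)]
      nlinarith [h.1]
    linarith
  · linarith [Real.log_le_sub_one_of_pos hy0, h.2]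

/-- **Logarithmic form of (B.12)** (the form used in [FS81, (B.14)]: `ln I_β(n) - ln L_β(n) = O(σ⁻²)`):
for `x ≥ 100` and every `n ∈ ℤ`, with `s = √(x²+n²)`,
`|log I_n(x) - (s - n sinh⁻¹(n/x) - ½ log(2πs))| ≤ 100/s ≤ 100/x`.
[cite: FrohlichSpencerKT1981, Appendix B, (B.12)–(B.14), p. 599] -/
theorem abs_log_besselI_sub_debye_le {x : ℝ} (hx : 100 ≤ x) (n : ℤ) :
    |Real.log (besselI n x) - (√(x ^ 2 + n ^ 2) - n * Real.arsinh (n / x) -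
        Real.log (2 * π * √(x ^ 2 + n ^ 2)) / 2)| ≤ 100 / √(x ^ 2 + n ^ 2) := by
  have hx0 : 0 < x := by linarith
  have h := abs_besselI_mul_debye_sub_one_le hx0 n
  set s := √(x ^ 2 + n ^ 2) with hs_def
  set r := Real.arsinh (n / x)
  have hs : 0 < s := Real.sqrt_pos.2 (by positivity)
  have hxs : x ≤ s := by
    rw [hs_def]
    apply Real.le_sqrt_of_sq_le
    nlinarith
  have hs100 : 100 ≤ s := le_trans hx hxs
  have hε : 50 / s ≤ 1 / 2 := by
    rw [div_le_div_iff₀ hs (by norm_num)]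
    linarith
  have hlog := abs_log_le_of_abs_sub_one_le h hε
  have hI : 0 < besselI n x := besselI_pos hx0 n
  have hsq : 0 < √(2 * π * s) := Real.sqrt_pos.2 (by positivity)
  have hexpand : Real.log (besselI n x * (√(2 * π * s) * Real.exp (n * r - s))) =
      Real.log (besselI n x) - (s - n * r - Real.log (2 * π * s) / 2) := by
    rw [Real.log_mul hI.ne' (by positivity), Real.log_mul hsq.ne' (Real.exp_pos _).ne',
      Real.log_exp, Real.log_sqrt (by positivity)]
    ring
  rw [hexpand] at hlog
  calc _ ≤ 2 * (50 / s) := hlog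
    _ = 100 / s := by ring

end Literature.Probability.LatticeModels
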